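import Mathlib.Analysis.MeanInequalities
import Mathlib.Analysis.PSeries
import Mathlib.Analysis.SpecialFunctions.Pow.Real
import Mathlib.NumberTheory.Harmonic.Bounds
import Literature.Geometry.MetricEmbeddings.HeisenbergL1Proofs
import Literature.Geometry.MetricEmbeddings.CutCone
import HarnessLib

/-!
# The Naor–Young route to `CheegerKleinerNaor2011_wordBall_l1Distortion`: the `L₁`-distortion of
Heisenberg word balls from the vertical-versus-horizontal isoperimetric inequality on `ℍ_ℤ³`

Family `pnp`, layer `Literature/Geometry/MetricEmbeddings`; third sibling proofs file of
`HeisenbergL1.lean` (theorems only). PROVED here: the vendored Cheeger–Kleiner–Naor named fact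
(`c₁(𝔅_r, d_W) ≥ κ (log r)^δ` for word balls of `ℍ(ℤ)`, `HeisenbergL1.lean`) FOLLOWS, with
`δ = 1/4`, from the endpoint (`q = 4`) discrete vertical-versus-horizontal isoperimetric inequality of
Naor–Young, taken as an explicit hypothesis (`CheegerKleinerNaor2011_wordBall_l1Distortion.of_verticalVsHorizontal`).
Sources read, verbatim:

* A. Naor, R. Young, *Vertical perimeter versus horizontal perimeter*, Ann. of Math. 188 (2018)
  171–279 = arXiv:1701.00620. §1 (arXiv p. 3): `ℍ_ℤ^{2k+1} = ⟨a_1,b_1,…,a_k,b_k,c | c = [a_i,b_i]`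
  central`⟩`, `𝔖_k = {a_i^{±1}, b_i^{±1}}`, realized by upper unitriangular integer matrices (for
  `k = 1`: `heisMul` of `HeisenbergL1.lean`, `a = (1,0,0)`, `b = (0,1,0)`, `c = [a,b] = (0,0,1)`).
  Def. 1.1: "`∂_h Ω ≝ {(x,y) ∈ Ω × (ℍ_ℤ ∖ Ω) : x⁻¹y ∈ 𝔖_k}` […]
  `∂ᵗ_v Ω ≝ {(x,y) ∈ Ω × (ℍ_ℤ ∖ Ω) : x⁻¹y ∈ {cᵗ, c⁻ᵗ}}`". Remark 1.4 (arXiv p. 4): "there exists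
  `q ∈ (2,∞)` such that for every `Ω ⊂ ℍ_ℤ³` we have `(Σ_{t=1}^∞ |∂ᵗ_vΩ|^q/t^{1+q/2})^{1/q} ≲ |∂_hΩ|`".
  §1.2–1.3 (arXiv pp. 6–8): the deduction "local vertical-versus-horizontal inequality ⇒
  `c₁(𝔅_r, d_W) ≳ …`" ("fix universal constants `β ∈ (0,1)`, `γ` such that
  `β√t ≤ d_W(cᵗ,1) ≤ γ√t` […] If `t ∈ {1,…,n²}` and `h ∈ 𝓑_n` then `d_W(hcᵗ,1) ≤ n + γ√t` […]
  `‖φ(hcᵗ) − φ(h)‖ ≳ ω(d_W(cᵗ,1))` […] The right hand side […] is at most a universal constant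
  multiple of `|𝓑_{αn}|·|𝔖|`"), §3.1 (arXiv pp. 19–21): Lemma 3.1 (sets ↔ functions by the co-area
  formula), Lemma 3.2 (real ↔ `L_p(μ)`-valued), Lemma 3.3 (global ↔ local on balls).
* A. Naor, R. Young, *Foliated corona decompositions*, Acta Math. 229 (2022) 55–200 =
  arXiv:2004.12522, Thm. 1.1 (the `L₄` inequality on `ℍ³`) and §1.1.1 (arXiv p. 5): "if every
  compactly supported smooth function `f : ℝ³ → ℝ` satisfies the inequality (1.7) [with exponent `p`]
  then by [NY18] and the reasoning in [NY18] we have `c_{ℓ₁}(𝓑_n) ≳ (log n)^{1/p}`. Thus,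
  `c_{ℓ₁}(𝓑_n) ≳ ⁴√(log n)`, since Theorem 1.1 asserts that (1.7) holds for `p = 4`" — the discrete
  form being the case `q = 4` (`1 + q/2 = 3`) of the display of [NY18, Rem. 1.4], via [NY18, Lemmas
  3.1, 3.6].

## The hypothesis and the argument

The hypothesis `hX` of the main theorem is the discrete inequality with `q = 4`, transcribed on the
carrier `ℤ × ℤ × ℤ` of `HeisenbergL1.lean`: there is `C` with, for every finite `Ω`,
`(Σ_{t≥1} |∂ᵗ_v Ω|⁴/t³)^{1/4} ≤ C |∂_h Ω|`, where the two perimeters are COUNTED as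
`|∂ᵗ_v Ω| = #{x ∈ Ω : x·cᵗ ∉ Ω} + #{x ∈ Ω : x·c⁻ᵗ ∉ Ω}` (`x·c^{±t} = (x₁, x₂, x₃ ± t)`) and
`|∂_h Ω| = #{(x,σ) ∈ Ω × 𝔖₁ : x·σ ∉ Ω}` (the printed sets of ordered pairs `(x, x·c^{±t})`,
`(x, x·σ)`, counted through their first coordinate and label; `of_verticalVsHorizontal_pairs`
restates the hypothesis with the boundaries as those pair sets themselves, via
`card_hBoundaryPairs`, `card_vBoundaryPairs`). The proof follows [NY18 §1.3, §3.1]: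
(1) cut-cone decomposition of the `ℓ₁^N`-valued map on a ball (`exists_cut_decomposition`,
`CutCone.lean`; the finite form of Lemmas 3.1–3.2), cuts complemented so as not to contain `1`;
(2) the hypothesis applied to each cut restricted to a ball `𝓑_m`, the count of vertically
separated pairs in `𝓑_n` being at most `|∂ᵗ_v|` of the restricted cut (`9n ≤ m`, as
`𝓑_n·cᵗ ⊆ 𝓑_{9n}` for `t ≤ n²` by `dist_zero_center_le_of_sq`); (3) Minkowski's inequality in
`ℓ₄` over the cuts (`rpow_sum_le_sum_rpow_of_nonneg`); (4) LOCALISATION by restriction of the cuts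
to `𝓑_m` and a pigeonhole choice of `m ∈ (9n, 18n]` with a thin sphere `|𝓑_m ∖ 𝓑_{m-1}| ≤ |𝓑_{18n}|/9n`
— this replaces the cutoff-function/Poincaré-inequality localisation of [NY18, Lemmas 3.3–3.4] by a
shorter argument with the same output; (5) the assembly of [NY18, p. 8]: `V_t ≥ |𝓑_n| d_W(1,cᵗ)`,
`d_W(1,cᵗ)² ≥ t` (`abs_sub_le_dist`), `Σ_{t≤n²} 1/t ≥ log(n²+1)` (`log_add_one_le_harmonic`),
quartic growth `|𝓑_{18n}| ≤ Λ|𝓑_n|` (`ncard_wordBall_le`, `le_ncard_wordBall`), giving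
`log r ≤ (12·C·Λ·D)⁴` for `r ≥ 400`, `n = ⌊r/18⌋`, and `D ≥ 1` for `r < 400`. The argument only
consumes the un-rooted partial sums `Σ_{t=1}^{T} |∂ᵗ_v Ω|⁴/t³ ≤ (C|∂_hΩ|)⁴`, and is stated in that
form as `of_partialSums` (the entry point of the discretization files, which derive these partial
sums from the continuous `L₄` inequality of [NY22, Thm. 1.1]).

Not here: the isoperimetric inequality itself ([NY22] §§2–6, foliated corona decompositions, and
the discretization [NY18, Lemma 3.6]) — an XL theory absent from Mathlib; hence the named fact is not
discharged by this file.

## References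

* [NaorYoung2018] A. Naor, R. Young, Ann. of Math. 188 (2018) 171–279, §1 Def. 1.1, Rem. 1.4,
  §§1.2–1.3, §3.1 (arXiv:1701.00620 pp. 3–8, 19–21; item numbers as in the arXiv version).
* [NaorYoung2022] A. Naor, R. Young, Acta Math. 229 (2022) 55–200, Thm. 1.1, §1.1.1, Thm. 1.6
  (arXiv:2004.12522 pp. 3–5).
* [CheegerKleinerNaor2011] J. Cheeger, B. Kleiner, A. Naor, Acta Math. 207 (2011), Cor. 1.2.
-/

noncomputable section

open Finset

namespace Literature.Geometry.MetricEmbeddings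

/-! ### Minkowski's inequality over a finite family of summands -/

/-- **Minkowski's inequality in `ℓ_p` for finitely many summands** (`p ≥ 1`, nonnegative entries):
`(Σ_t (Σ_i a_{i,t})^p)^{1/p} ≤ Σ_i (Σ_t a_{i,t}^p)^{1/p}` (induction on the two-summand inequality
`Real.Lp_add_le`). [folklore] -/
theorem rpow_sum_le_sum_rpow_of_nonneg {ι τ : Type*} (s : Finset ι) (T : Finset τ) (a : ι → τ → ℝ)
    (ha : ∀ i t, 0 ≤ a i t) {p : ℝ} (hp : 1 ≤ p) :
    (∑ t ∈ T, (∑ i ∈ s, a i t) ^ p) ^ (1 / p) ≤ ∑ i ∈ s, (∑ t ∈ T, a i t ^ p) ^ (1 / p) := by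
  classical
  induction s using Finset.induction_on with
  | empty =>
    have hp0 : p ≠ 0 := by linarith
    have hp0' : p⁻¹ ≠ 0 := inv_ne_zero hp0
    simp [Real.zero_rpow hp0, Real.zero_rpow hp0']
  | insert j s hj ih =>
    rw [Finset.sum_insert hj]
    have h1 : (∑ t ∈ T, (∑ i ∈ insert j s, a i t) ^ p) ^ (1 / p) =
        (∑ t ∈ T, |a j t + ∑ i ∈ s, a i t| ^ p) ^ (1 / p) := by
      congr 1
      refine Finset.sum_congr rfl fun t _ => ?_
      rw [Finset.sum_insert hj,
        abs_of_nonneg (add_nonneg (ha j t) (Finset.sum_nonneg fun i _ => ha i t))]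
    have h2 : (∑ t ∈ T, |a j t| ^ p) ^ (1 / p) = (∑ t ∈ T, a j t ^ p) ^ (1 / p) := by
      congr 1
      exact Finset.sum_congr rfl fun t _ => by rw [abs_of_nonneg (ha j t)]
    have h3 : (∑ t ∈ T, |∑ i ∈ s, a i t| ^ p) ^ (1 / p) =
        (∑ t ∈ T, (∑ i ∈ s, a i t) ^ p) ^ (1 / p) := by
      congr 1
      exact Finset.sum_congr rfl fun t _ => by
        rw [abs_of_nonneg (Finset.sum_nonneg fun i _ => ha i t)]
    rw [h1]
    calc (∑ t ∈ T, |a j t + ∑ i ∈ s, a i t| ^ p) ^ (1 / p)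
        ≤ (∑ t ∈ T, |a j t| ^ p) ^ (1 / p) + (∑ t ∈ T, |∑ i ∈ s, a i t| ^ p) ^ (1 / p) :=
          Real.Lp_add_le T _ _ hp
      _ = (∑ t ∈ T, a j t ^ p) ^ (1 / p) + (∑ t ∈ T, (∑ i ∈ s, a i t) ^ p) ^ (1 / p) := by
          rw [h2, h3]
      _ ≤ (∑ t ∈ T, a j t ^ p) ^ (1 / p) + ∑ i ∈ s, (∑ t ∈ T, a i t ^ p) ^ (1 / p) := by
          gcongr

/-- **Weighted fourth-power Minkowski**: for weights `μ_t ≥ 0` and nonnegative `a_{i,t}`, if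
`Σ_t μ_t a_{i,t}⁴ ≤ b_i⁴` (`b_i ≥ 0`) for every `i`, then `Σ_t μ_t (Σ_i a_{i,t})⁴ ≤ (Σ_i b_i)⁴`.
[folklore] -/
theorem sum_mul_sum_pow_four_le {ι τ : Type*} (s : Finset ι) (T : Finset τ) (μ : τ → ℝ)
    (hμ : ∀ t, 0 ≤ μ t) (a : ι → τ → ℝ) (ha : ∀ i t, 0 ≤ a i t) (b : ι → ℝ) (hb : ∀ i, 0 ≤ b i)
    (hab : ∀ i ∈ s, ∑ t ∈ T, μ t * a i t ^ 4 ≤ b i ^ 4) :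
    ∑ t ∈ T, μ t * (∑ i ∈ s, a i t) ^ 4 ≤ (∑ i ∈ s, b i) ^ 4 := by
  -- absorb the weights: `c_{i,t} = μ_t^{1/4} a_{i,t}`
  set c : ι → τ → ℝ := fun i t => μ t ^ (1 / 4 : ℝ) * a i t with hc
  have hc0 : ∀ i t, 0 ≤ c i t := fun i t => mul_nonneg (Real.rpow_nonneg (hμ t) _) (ha i t)
  have hμ4 : ∀ t, (μ t ^ (1 / 4 : ℝ)) ^ (4 : ℝ) = μ t := fun t => by
    rw [← Real.rpow_mul (hμ t)]
    norm_num
  have hpow : ∀ (x : ℝ) t, 0 ≤ x → (μ t ^ (1 / 4 : ℝ) * x) ^ (4 : ℝ) = μ t * x ^ 4 := by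
    intro x t hx
    rw [Real.mul_rpow (Real.rpow_nonneg (hμ t) _) hx, hμ4 t]
    norm_num
  have h4 : (1 : ℝ) ≤ 4 := by norm_num
  have hM := rpow_sum_le_sum_rpow_of_nonneg s T c hc0 h4
  -- rewrite both sides of Minkowski
  have hL : ∑ t ∈ T, (∑ i ∈ s, c i t) ^ (4 : ℝ) = ∑ t ∈ T, μ t * (∑ i ∈ s, a i t) ^ 4 := by
    refine Finset.sum_congr rfl fun t _ => ?_
    have : ∑ i ∈ s, c i t = μ t ^ (1 / 4 : ℝ) * ∑ i ∈ s, a i t := by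
      rw [Finset.mul_sum]
    rw [this, hpow _ t (Finset.sum_nonneg fun i _ => ha i t)]
  have hR : ∀ i ∈ s, (∑ t ∈ T, c i t ^ (4 : ℝ)) ^ (1 / 4 : ℝ) ≤ b i := by
    intro i hi
    have h1 : ∑ t ∈ T, c i t ^ (4 : ℝ) = ∑ t ∈ T, μ t * a i t ^ 4 :=
      Finset.sum_congr rfl fun t _ => hpow _ t (ha i t)
    rw [h1]
    have h2 : b i = (b i ^ 4) ^ (1 / 4 : ℝ) := by
      rw [← Real.rpow_natCast, ← Real.rpow_mul (hb i)]
      norm_num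
    rw [h2]
    exact Real.rpow_le_rpow (Finset.sum_nonneg fun t _ => mul_nonneg (hμ t) (pow_nonneg (ha i t) 4))
      (hab i hi) (by norm_num)
  rw [hL] at hM
  have hS0 : 0 ≤ ∑ t ∈ T, μ t * (∑ i ∈ s, a i t) ^ 4 :=
    Finset.sum_nonneg fun t _ => mul_nonneg (hμ t) (pow_nonneg (Finset.sum_nonneg fun i _ => ha i t) 4)
  have hM' : (∑ t ∈ T, μ t * (∑ i ∈ s, a i t) ^ 4) ^ (1 / 4 : ℝ) ≤ ∑ i ∈ s, b i :=
    hM.trans (Finset.sum_le_sum hR)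
  calc ∑ t ∈ T, μ t * (∑ i ∈ s, a i t) ^ 4
      = ((∑ t ∈ T, μ t * (∑ i ∈ s, a i t) ^ 4) ^ (1 / 4 : ℝ)) ^ 4 := by
        rw [← Real.rpow_natCast, ← Real.rpow_mul hS0]
        norm_num
    _ ≤ (∑ i ∈ s, b i) ^ 4 := pow_le_pow_left₀ (Real.rpow_nonneg hS0 _) hM' 4

/-! ### Vertical shifts `x ↦ x·cᵗ` and word balls as finsets -/

/-- The vertical shift `x ↦ x·cᵗ = (x₁, x₂, x₃ + t)` (right multiplication by the central element
`cᵗ = (0,0,t)`, `c = [a,b]`). [cite: NaorYoung2018, §1 Def. 1.1] -/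
theorem heisMul_center (g : ℤ × ℤ × ℤ) (t : ℤ) :
    heisMul g (0, 0, t) = (g.1, g.2.1, g.2.2 + t) := by
  simp [heisMul]

/-- `d_W(g, g·cᵗ) = d_W(1, cᵗ)` (left-invariance). [cite: NaorYoung2018, §1.2] -/
theorem dist_vshift (g : ℤ × ℤ × ℤ) (t : ℤ) :
    cayleyGraph.dist g (g.1, g.2.1, g.2.2 + t) = cayleyGraph.dist (0, 0, 0) (0, 0, t) := by
  have h := dist_heisMul_left g (0, 0, 0) (0, 0, t)
  have h0 : heisMul g (0, 0, 0) = g := by simp [heisMul]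
  rw [h0, heisMul_center] at h
  exact h

/-- `t ≤ d_W(1, cᵗ)²` ("`β√t ≤ d_W(cᵗ, 1)`" with `β = 1`: a word of length `L` reaches height at
most `L²`). [cite: NaorYoung2018, §1.2] -/
theorem le_dist_center_sq (t : ℤ) : |t| ≤ (cayleyGraph.dist (0, 0, 0) (0, 0, t) : ℤ) ^ 2 := by
  have h := (abs_sub_le_dist ((0, 0, 0) : ℤ × ℤ × ℤ) (0, 0, t)).2.2
  simpa using h

/-- `𝓑_m · cᵗ ⊆ 𝓑_{m + 8n}` for `|t| ≤ 2n²` ("if `t ∈ {1,…,n²}` and `h ∈ 𝓑_n` then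
`d_W(hcᵗ, 1) ≤ n + γ√t`"). [cite: NaorYoung2018, §1.3] -/
theorem vshift_mem_wordBall {n m : ℕ} (hn : 1 ≤ n) {t : ℤ} (ht : |t| ≤ 2 * (n : ℤ) ^ 2)
    {g : ℤ × ℤ × ℤ} (hg : g ∈ wordBall m) : (g.1, g.2.1, g.2.2 + t) ∈ wordBall (m + 8 * n) := by
  rw [mem_wordBall_iff_dist_le] at hg ⊢
  calc cayleyGraph.dist (0, 0, 0) (g.1, g.2.1, g.2.2 + t)
      ≤ cayleyGraph.dist (0, 0, 0) g + cayleyGraph.dist g (g.1, g.2.1, g.2.2 + t) :=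
        cayleyGraph_connected.dist_triangle
    _ ≤ m + 8 * n := add_le_add hg (by rw [dist_vshift]; exact dist_zero_center_le_of_sq hn ht)

/-- Neighbours of `𝓑_m` lie in `𝓑_{m+1}`. [cite: NaorYoung2018, §1.3] -/
theorem mem_wordBall_succ_of_adj {m : ℕ} {g h : ℤ × ℤ × ℤ} (hg : g ∈ wordBall m)
    (hgh : cayleyGraph.Adj g h) : h ∈ wordBall (m + 1) := by
  rw [mem_wordBall_iff_dist_le] at hg ⊢
  calc cayleyGraph.dist (0, 0, 0) h ≤ cayleyGraph.dist (0, 0, 0) g + cayleyGraph.dist g h :=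
        cayleyGraph_connected.dist_triangle
    _ ≤ m + 1 := add_le_add hg (SimpleGraph.dist_eq_one_iff_adj.mpr hgh).le

/-- Right multiplication by a horizontal generator `σ ∈ 𝔖₁ = {a^{±1}, b^{±1}}` moves to a
neighbour: `d_W(x, x·σ) ≤ 1`. [cite: NaorYoung2018, §1] -/
theorem dist_heisMul_gen_le_one (x σ : ℤ × ℤ × ℤ)
    (hσ : σ ∈ ({(1, 0, 0), (-1, 0, 0), (0, 1, 0), (0, -1, 0)} : Finset (ℤ × ℤ × ℤ))) :
    cayleyGraph.dist x (heisMul x σ) ≤ 1 := by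
  obtain ⟨x1, x2, x3⟩ := x
  simp only [mem_insert, mem_singleton] at hσ
  rcases hσ with rfl | rfl | rfl | rfl
  · have h := dist_mulA_le x1 x2 x3 1
    simpa [heisMul] using h
  · have h := dist_mulA_le x1 x2 x3 (-1)
    simpa [heisMul, ← sub_eq_add_neg] using h
  · have h := dist_mulB_le x1 x2 x3 1
    simpa [heisMul] using h
  · have h := dist_mulB_le x1 x2 x3 (-1)
    simpa [heisMul, ← sub_eq_add_neg] using h

/-- **Word balls as finsets**: `ball n` is the finset of `wordBall n` (finite by
`wordBall_finite`). [cite: NaorYoung2018, §1.2] -/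
theorem wordBall_toFinset_mem {n : ℕ} {g : ℤ × ℤ × ℤ} :
    g ∈ (wordBall_finite n).toFinset ↔ g ∈ wordBall n :=
  Set.Finite.mem_toFinset _

/-- The finset of `wordBall n` has `|𝓑_n| = (wordBall n).ncard` elements. [cite: NaorYoung2018, §1.2] -/
theorem card_wordBall_toFinset (n : ℕ) :
    ((wordBall_finite n).toFinset).card = (wordBall n).ncard :=
  (Set.ncard_eq_toFinset_card (wordBall n) (wordBall_finite n)).symm

/-- Monotonicity of the ball finsets. [cite: NaorYoung2018, §1.2] -/
theorem wordBall_toFinset_mono {n m : ℕ} (h : n ≤ m) :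
    (wordBall_finite n).toFinset ⊆ (wordBall_finite m).toFinset := by
  intro g hg
  rw [wordBall_toFinset_mem] at hg ⊢
  exact wordBall_mono h hg


/-! ### Cuts: indicator algebra and the two boundary counts -/

/-- `|𝟙_S(g) − 𝟙_S(h)| = 𝟙[g, h separated by S]`. [folklore] -/
theorem abs_indicator_one_sub {α : Type*} (S : Set α) [DecidablePred (· ∈ S)] (g h : α) :
    |S.indicator (1 : α → ℝ) g - S.indicator 1 h| = if (g ∈ S ↔ h ∈ S) then 0 else 1 := by
  by_cases hg : g ∈ S <;> by_cases hh : h ∈ S <;> simp [hg, hh]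

/-- Cut semimetrics are invariant under complementing the cut. [folklore] -/
theorem abs_indicator_compl_sub {α : Type*} (S : Set α) (g h : α) :
    |Sᶜ.indicator (1 : α → ℝ) g - Sᶜ.indicator 1 h| = |S.indicator (1 : α → ℝ) g - S.indicator 1 h| := by
  classical
  rw [abs_indicator_one_sub, abs_indicator_one_sub]
  simp only [Set.mem_compl_iff, not_iff_not]

/-- **Vertically separated pairs versus the vertical boundary of the restricted cut.** If
`𝓑 ⊆ 𝓑'` and `𝓑·cˢ ⊆ 𝓑'`, the number of `h ∈ 𝓑` separated from `h·cˢ` by a cut `S` is at most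
`#{x ∈ Ω : x·cˢ ∉ Ω} + #{x ∈ Ω : x·c⁻ˢ ∉ Ω} = |∂ˢ_v Ω|` for `Ω = S ∩ 𝓑'` (`h ↦ (h, h·cˢ)` if
`h ∈ S`, `h ↦ (h·cˢ, h)` otherwise). [cite: NaorYoung2018, §1 Def. 1.1 and §3.1 Lemma 3.1] -/
theorem card_vsep_le (S : Set (ℤ × ℤ × ℤ)) [DecidablePred (· ∈ S)] {Bn Bm : Finset (ℤ × ℤ × ℤ)}
    (s : ℤ) (hsub : Bn ⊆ Bm) (hshift : ∀ h ∈ Bn, (h.1, h.2.1, h.2.2 + s) ∈ Bm) :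
    (Bn.filter fun h => ¬ ((h.1, h.2.1, h.2.2 + s) ∈ S ↔ h ∈ S)).card ≤
      ((Bm.filter (· ∈ S)).filter fun x => (x.1, x.2.1, x.2.2 + s) ∉ Bm.filter (· ∈ S)).card +
      ((Bm.filter (· ∈ S)).filter fun x => (x.1, x.2.1, x.2.2 - s) ∉ Bm.filter (· ∈ S)).card := by
  have hmemΩ : ∀ x, x ∈ Bm.filter (· ∈ S) ↔ x ∈ Bm ∧ x ∈ S := fun x => by simp
  have hsplit : (Bn.filter fun h => ¬ ((h.1, h.2.1, h.2.2 + s) ∈ S ↔ h ∈ S)) =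
      (Bn.filter fun h => h ∈ S ∧ (h.1, h.2.1, h.2.2 + s) ∉ S) ∪
      (Bn.filter fun h => h ∉ S ∧ (h.1, h.2.1, h.2.2 + s) ∈ S) := by
    ext h
    simp only [mem_filter, mem_union]
    tauto
  rw [hsplit]
  refine (card_union_le _ _).trans (add_le_add ?_ ?_)
  · refine card_le_card fun h hh => ?_
    rw [mem_filter] at hh ⊢
    exact ⟨(hmemΩ h).mpr ⟨hsub hh.1, hh.2.1⟩, fun hup => hh.2.2 ((hmemΩ _).mp hup).2⟩
  · refine card_le_card_of_injOn (fun h => (h.1, h.2.1, h.2.2 + s)) (fun h hh => ?_) ?_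
    · rw [mem_coe, mem_filter] at hh
      rw [mem_coe, mem_filter]
      refine ⟨(hmemΩ _).mpr ⟨hshift h hh.1, hh.2.2⟩, ?_⟩
      have e : ((h.1, h.2.1, h.2.2 + s).1, (h.1, h.2.1, h.2.2 + s).2.1,
          (h.1, h.2.1, h.2.2 + s).2.2 - s) = h := by
        ext <;> simp
      rw [e]
      exact fun hΩ => hh.2.1 ((hmemΩ h).mp hΩ).2
    · intro h _ h' _ heq
      simp only [Prod.mk.injEq, add_left_inj] at heq
      exact Prod.ext heq.1 (Prod.ext heq.2.1 heq.2.2)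

/-- **Weighted horizontal perimeters of restricted cuts.** For cuts `E_i` not containing `1`,
weights `w_i ≥ 0`, and `Ω_i = E_i ∩ 𝓑` (`1 ∈ 𝓑`): `Σ_i w_i |∂_h Ω_i|` is at most the sum over
`x ∈ 𝓑`, `σ ∈ 𝔖₁` of the `w`-mass of cuts separating `x` from `x·σ` (if `x·σ ∈ 𝓑`) or from `1`
(if `x·σ ∉ 𝓑`). [cite: NaorYoung2018, §1 Def. 1.1 and §3.1 Lemma 3.1] -/
theorem sum_mul_hper_le {ι : Type*} (sι : Finset ι) (w : ι → ℝ) (hw : ∀ i, 0 ≤ w i)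
    (E : ι → Set (ℤ × ℤ × ℤ)) [∀ i, DecidablePred (· ∈ E i)] (Bm : Finset (ℤ × ℤ × ℤ))
    (he : ∀ i, ((0 : ℤ), (0 : ℤ), (0 : ℤ)) ∉ E i) :
    ∑ i ∈ sι, w i * ((((Bm.filter (· ∈ E i)) ×ˢ
        ({(1, 0, 0), (-1, 0, 0), (0, 1, 0), (0, -1, 0)} : Finset (ℤ × ℤ × ℤ))).filter
          fun p => heisMul p.1 p.2 ∉ Bm.filter (· ∈ E i)).card : ℝ) ≤
      ∑ x ∈ Bm, ∑ σ ∈ ({(1, 0, 0), (-1, 0, 0), (0, 1, 0), (0, -1, 0)} : Finset (ℤ × ℤ × ℤ)),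
        if heisMul x σ ∈ Bm then ∑ i ∈ sι, w i * (if (x ∈ E i ↔ heisMul x σ ∈ E i) then 0 else 1)
        else ∑ i ∈ sι, w i * (if (x ∈ E i ↔ ((0 : ℤ), (0 : ℤ), (0 : ℤ)) ∈ E i) then 0 else 1) := by
  set gens : Finset (ℤ × ℤ × ℤ) := {(1, 0, 0), (-1, 0, 0), (0, 1, 0), (0, -1, 0)} with hgens
  have hcount : ∀ i, ((((Bm.filter (· ∈ E i)) ×ˢ gens).filter
      fun p => heisMul p.1 p.2 ∉ Bm.filter (· ∈ E i)).card : ℝ) =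
      ∑ x ∈ Bm, ∑ σ ∈ gens,
        (if x ∈ E i ∧ heisMul x σ ∉ Bm.filter (· ∈ E i) then (1 : ℝ) else 0) := by
    intro i
    rw [natCast_card_filter, sum_product, sum_filter]
    refine sum_congr rfl fun x _ => ?_
    split_ifs with hx
    · exact sum_congr rfl fun σ _ => by simp [hx]
    · symm
      exact sum_eq_zero fun σ _ => by simp [hx]
  calc ∑ i ∈ sι, w i * ((((Bm.filter (· ∈ E i)) ×ˢ gens).filter
          fun p => heisMul p.1 p.2 ∉ Bm.filter (· ∈ E i)).card : ℝ)
      = ∑ i ∈ sι, ∑ x ∈ Bm, ∑ σ ∈ gens,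
          w i * (if x ∈ E i ∧ heisMul x σ ∉ Bm.filter (· ∈ E i) then (1 : ℝ) else 0) := by
        refine sum_congr rfl fun i _ => ?_
        rw [hcount i, mul_sum]
        exact sum_congr rfl fun x _ => by rw [mul_sum]
    _ = ∑ x ∈ Bm, ∑ σ ∈ gens, ∑ i ∈ sι,
          w i * (if x ∈ E i ∧ heisMul x σ ∉ Bm.filter (· ∈ E i) then (1 : ℝ) else 0) := by
        rw [sum_comm]
        exact sum_congr rfl fun x _ => sum_comm
    _ ≤ _ := by
        refine sum_le_sum fun x _ => sum_le_sum fun σ _ => ?_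
        split_ifs with hB
        · refine sum_le_sum fun i _ => mul_le_mul_of_nonneg_left ?_ (hw i)
          by_cases h1 : x ∈ E i ∧ heisMul x σ ∉ Bm.filter (· ∈ E i)
          · have h2 : heisMul x σ ∉ E i := fun hmem => h1.2 (mem_filter.mpr ⟨hB, hmem⟩)
            simp [h1, h2]
          · rw [if_neg h1]
            split_ifs <;> norm_num
        · refine sum_le_sum fun i _ => mul_le_mul_of_nonneg_left ?_ (hw i)
          by_cases h1 : x ∈ E i ∧ heisMul x σ ∉ Bm.filter (· ∈ E i)
          · simp [h1, he i]
          · rw [if_neg h1]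
            split_ifs <;> norm_num


/-! ### The local inequality on balls -/

/-- **Local `ℓ₁^N`-valued vertical-versus-horizontal inequality on word balls** (the finite form
of the local inequality of [NY18, §1.3 / Lemma 3.3] for `k = 1`, `q = 4`, obtained here by
restricting cuts to a ball).
Assume the discrete isoperimetric inequality in the counted form
`Σ_{t=1}^{T} |∂ᵗ_v Ω|⁴/t³ ≤ (C |∂_h Ω|)⁴` for all finite `Ω` and `T`. Then for every
`F : ℍ_ℤ³ → ℓ₁^N`, `n ≥ 1` and `m ≥ 9n`,
`Σ_{t=1}^{n²} (Σ_{h ∈ 𝓑_n} ‖F(hcᵗ) − F(h)‖₁)⁴ / t³ ≤ (C·R)⁴`, where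
`R = Σ_{x ∈ 𝓑_m} Σ_{σ ∈ 𝔖₁} (‖F(x) − F(xσ)‖₁ if xσ ∈ 𝓑_m, else ‖F(x) − F(1)‖₁)`.
Proof: cut-cone decomposition of `F` on `𝓑_m` (cuts complemented to avoid `1`), the hypothesis
for each cut `Ω_i = E_i ∩ 𝓑_m` (`card_vsep_le`), Minkowski in `ℓ₄` over the cuts
(`sum_mul_sum_pow_four_le`), and `sum_mul_hper_le`.
[cite: NaorYoung2018, §1.3 (the local inequality on balls) and §3.1 Lemmas 3.1–3.3] -/
theorem local_vertical_le {C : ℝ} (hC0 : 0 ≤ C)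
    (hC : ∀ (Ω : Finset (ℤ × ℤ × ℤ)) (T : ℕ),
      ∑ t ∈ Finset.range T,
        (((Ω.filter fun x => (x.1, x.2.1, x.2.2 + ((t : ℤ) + 1)) ∉ Ω).card : ℝ) +
          ((Ω.filter fun x => (x.1, x.2.1, x.2.2 - ((t : ℤ) + 1)) ∉ Ω).card : ℝ)) ^ 4 /
          ((t : ℝ) + 1) ^ 3 ≤
      (C * ((Ω ×ˢ ({(1, 0, 0), (-1, 0, 0), (0, 1, 0), (0, -1, 0)} : Finset (ℤ × ℤ × ℤ))).filter
          fun p => heisMul p.1 p.2 ∉ Ω).card) ^ 4)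
    {N : ℕ} (F : ℤ × ℤ × ℤ → Fin N → ℝ) {n m : ℕ} (hn : 1 ≤ n) (hm : 9 * n ≤ m) :
    ∑ t ∈ Finset.range (n ^ 2),
      (∑ h ∈ (wordBall_finite n).toFinset,
          ∑ k, |F (h.1, h.2.1, h.2.2 + ((t : ℤ) + 1)) k - F h k|) ^ 4 / ((t : ℝ) + 1) ^ 3 ≤
    (C * ∑ x ∈ (wordBall_finite m).toFinset,
        ∑ σ ∈ ({(1, 0, 0), (-1, 0, 0), (0, 1, 0), (0, -1, 0)} : Finset (ℤ × ℤ × ℤ)),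
          (if heisMul x σ ∈ (wordBall_finite m).toFinset then ∑ k, |F x k - F (heisMul x σ) k|
            else ∑ k, |F x k - F (0, 0, 0) k|)) ^ 4 := by
  classical
  set gens : Finset (ℤ × ℤ × ℤ) := {(1, 0, 0), (-1, 0, 0), (0, 1, 0), (0, -1, 0)} with hgens
  set Bn := (wordBall_finite n).toFinset with hBn
  set Bm := (wordBall_finite m).toFinset with hBm
  -- geometry: `𝓑_n ⊆ 𝓑_m`, `𝓑_n · c^{t+1} ⊆ 𝓑_m` for `t < n²`, `1 ∈ 𝓑_m`
  have hsub : Bn ⊆ Bm := wordBall_toFinset_mono (by omega)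
  have hshift : ∀ t, t < n ^ 2 → ∀ h ∈ Bn, (h.1, h.2.1, h.2.2 + ((t : ℤ) + 1)) ∈ Bm := by
    intro t ht h hh
    rw [hBn, wordBall_toFinset_mem] at hh
    rw [hBm, wordBall_toFinset_mem]
    have habs : |(t : ℤ) + 1| ≤ 2 * (n : ℤ) ^ 2 := by
      rw [abs_of_nonneg (by positivity)]
      have h1 : t + 1 ≤ n ^ 2 := ht
      have h2 : ((t : ℤ) + 1) ≤ (n : ℤ) ^ 2 := by exact_mod_cast h1
      nlinarith
    exact wordBall_mono (by omega) (vshift_mem_wordBall (m := n) hn habs hh)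
  have he : ((0 : ℤ), (0 : ℤ), (0 : ℤ)) ∈ Bm := by
    rw [hBm, wordBall_toFinset_mem]
    exact zero_mem_wordBall m
  -- (1) cut decomposition on `𝓑_m`, cuts complemented so as not to contain `1`
  obtain ⟨ι, hι, w, E, hw, hrepr⟩ := exists_cut_decomposition Bm F
  set E' : ι → Set (ℤ × ℤ × ℤ) := fun i =>
    if ((0 : ℤ), (0 : ℤ), (0 : ℤ)) ∈ E i then (E i)ᶜ else E i with hE'
  have hE'e : ∀ i, ((0 : ℤ), (0 : ℤ), (0 : ℤ)) ∉ E' i := by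
    intro i
    by_cases h0 : ((0 : ℤ), (0 : ℤ), (0 : ℤ)) ∈ E i
    · simp [hE', h0]
    · simp [hE', h0]
  have hE'ind : ∀ i (g h : ℤ × ℤ × ℤ),
      |(E' i).indicator (1 : ℤ × ℤ × ℤ → ℝ) g - (E' i).indicator 1 h| =
        |(E i).indicator (1 : ℤ × ℤ × ℤ → ℝ) g - (E i).indicator 1 h| := by
    intro i g h
    by_cases h0 : ((0 : ℤ), (0 : ℤ), (0 : ℤ)) ∈ E i
    · simp only [hE', h0, if_true]
      exact abs_indicator_compl_sub _ _ _
    · simp only [hE', h0, if_false]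
  have hrepr' : ∀ g ∈ Bm, ∀ h ∈ Bm,
      ∑ k, |F g k - F h k| = ∑ i, w i * (if (g ∈ E' i ↔ h ∈ E' i) then (0 : ℝ) else 1) := by
    intro g hg h hh
    rw [hrepr g hg h hh]
    refine Finset.sum_congr rfl fun i _ => ?_
    rw [← abs_indicator_one_sub, hE'ind]
  -- the counts: separated pairs `A i t`, vertical perimeter `vp i t`, horizontal perimeter `hper i`
  set A : ι → ℕ → ℝ := fun i t =>
    ((Bn.filter fun h => ¬ ((h.1, h.2.1, h.2.2 + ((t : ℤ) + 1)) ∈ E' i ↔ h ∈ E' i)).card : ℝ)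
    with hAdef
  set vp : ι → ℕ → ℝ := fun i t =>
    (((Bm.filter (· ∈ E' i)).filter fun x =>
        (x.1, x.2.1, x.2.2 + ((t : ℤ) + 1)) ∉ Bm.filter (· ∈ E' i)).card : ℝ) +
      (((Bm.filter (· ∈ E' i)).filter fun x =>
        (x.1, x.2.1, x.2.2 - ((t : ℤ) + 1)) ∉ Bm.filter (· ∈ E' i)).card : ℝ) with hvpdef
  set hper : ι → ℝ := fun i => ((((Bm.filter (· ∈ E' i)) ×ˢ gens).filter
      fun p => heisMul p.1 p.2 ∉ Bm.filter (· ∈ E' i)).card : ℝ) with hhper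
  have hA0 : ∀ i t, 0 ≤ A i t := fun i t => by positivity
  have hper0 : ∀ i, 0 ≤ hper i := fun i => by positivity
  -- (2) `V_t = Σ_i w_i A_i(t)`
  have hV : ∀ t, t < n ^ 2 →
      ∑ h ∈ Bn, ∑ k, |F (h.1, h.2.1, h.2.2 + ((t : ℤ) + 1)) k - F h k| = ∑ i, w i * A i t := by
    intro t ht
    calc ∑ h ∈ Bn, ∑ k, |F (h.1, h.2.1, h.2.2 + ((t : ℤ) + 1)) k - F h k|
        = ∑ h ∈ Bn, ∑ i, w i *
            (if ((h.1, h.2.1, h.2.2 + ((t : ℤ) + 1)) ∈ E' i ↔ h ∈ E' i) then (0 : ℝ) else 1) :=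
          Finset.sum_congr rfl fun h hh => hrepr' _ (hshift t ht h hh) _ (hsub hh)
      _ = ∑ i, ∑ h ∈ Bn, w i *
            (if ((h.1, h.2.1, h.2.2 + ((t : ℤ) + 1)) ∈ E' i ↔ h ∈ E' i) then (0 : ℝ) else 1) :=
          Finset.sum_comm
      _ = ∑ i, w i * A i t := by
          refine Finset.sum_congr rfl fun i _ => ?_
          rw [← Finset.mul_sum]
          congr 1
          simp only [hAdef]
          rw [natCast_card_filter]
          refine Finset.sum_congr rfl fun h _ => ?_
          rw [ite_not]
  -- (3) `A_i(t) ≤ |∂^{t+1}_v Ω_i|`, `Ω_i = E'_i ∩ 𝓑_m` (`card_vsep_le`)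
  have hA : ∀ i, ∀ t, t < n ^ 2 → A i t ≤ vp i t := by
    intro i t ht
    have h := card_vsep_le (E' i) ((t : ℤ) + 1) hsub (hshift t ht)
    simp only [hAdef, hvpdef]
    exact_mod_cast h
  -- (4) Minkowski over the cuts, with the hypothesis on each `Ω_i`
  have hmain : ∑ t ∈ Finset.range (n ^ 2), (1 / ((t : ℝ) + 1) ^ 3) * (∑ i, w i * A i t) ^ 4 ≤
      (∑ i, w i * (C * hper i)) ^ 4 := by
    refine sum_mul_sum_pow_four_le (Finset.univ : Finset ι) (Finset.range (n ^ 2))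
      (fun t => 1 / ((t : ℝ) + 1) ^ 3) (fun t => by positivity) (fun i t => w i * A i t)
      (fun i t => mul_nonneg (hw i) (hA0 i t)) (fun i => w i * (C * hper i))
      (fun i => mul_nonneg (hw i) (mul_nonneg hC0 (hper0 i))) fun i _ => ?_
    have hCi : ∑ t ∈ Finset.range (n ^ 2), vp i t ^ 4 / ((t : ℝ) + 1) ^ 3 ≤ (C * hper i) ^ 4 := by
      have h := hC (Bm.filter (· ∈ E' i)) (n ^ 2)
      simp only [hvpdef, hhper]
      exact h
    calc ∑ t ∈ Finset.range (n ^ 2), 1 / ((t : ℝ) + 1) ^ 3 * (w i * A i t) ^ 4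
        ≤ ∑ t ∈ Finset.range (n ^ 2), w i ^ 4 * (vp i t ^ 4 / ((t : ℝ) + 1) ^ 3) := by
          refine Finset.sum_le_sum fun t ht => ?_
          rw [Finset.mem_range] at ht
          have hAt := hA i t ht
          have hAt0 := hA0 i t
          calc 1 / ((t : ℝ) + 1) ^ 3 * (w i * A i t) ^ 4
              = w i ^ 4 * (A i t ^ 4 * (1 / ((t : ℝ) + 1) ^ 3)) := by ring
            _ ≤ w i ^ 4 * (vp i t ^ 4 * (1 / ((t : ℝ) + 1) ^ 3)) := by gcongr
            _ = w i ^ 4 * (vp i t ^ 4 / ((t : ℝ) + 1) ^ 3) := by ring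
      _ = w i ^ 4 * ∑ t ∈ Finset.range (n ^ 2), vp i t ^ 4 / ((t : ℝ) + 1) ^ 3 := by
          rw [Finset.mul_sum]
      _ ≤ w i ^ 4 * (C * hper i) ^ 4 := mul_le_mul_of_nonneg_left hCi (pow_nonneg (hw i) 4)
      _ = (w i * (C * hper i)) ^ 4 := by ring
  -- (5) the weighted horizontal perimeters are at most `R` (`sum_mul_hper_le`)
  have hR : ∑ i, w i * (C * hper i) ≤ C * ∑ x ∈ Bm, ∑ σ ∈ gens,
      (if heisMul x σ ∈ Bm then ∑ k, |F x k - F (heisMul x σ) k|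
        else ∑ k, |F x k - F (0, 0, 0) k|) := by
    have h1 : ∑ i, w i * (C * hper i) = C * ∑ i, w i * hper i := by
      rw [Finset.mul_sum]
      exact Finset.sum_congr rfl fun i _ => by ring
    rw [h1]
    refine mul_le_mul_of_nonneg_left ?_ hC0
    have h2 := sum_mul_hper_le (Finset.univ : Finset ι) w hw E' Bm hE'e
    refine h2.trans (le_of_eq ?_)
    refine Finset.sum_congr rfl fun x hx => Finset.sum_congr rfl fun σ _ => ?_
    split_ifs with hB
    · exact (hrepr' x hx _ hB).symm
    · exact (hrepr' x hx _ he).symm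
  -- assemble
  calc ∑ t ∈ Finset.range (n ^ 2),
        (∑ h ∈ Bn, ∑ k, |F (h.1, h.2.1, h.2.2 + ((t : ℤ) + 1)) k - F h k|) ^ 4 / ((t : ℝ) + 1) ^ 3
      = ∑ t ∈ Finset.range (n ^ 2), (1 / ((t : ℝ) + 1) ^ 3) * (∑ i, w i * A i t) ^ 4 := by
        refine Finset.sum_congr rfl fun t ht => ?_
        rw [Finset.mem_range] at ht
        rw [hV t ht, div_eq_mul_one_div, mul_comm]
    _ ≤ (∑ i, w i * (C * hper i)) ^ 4 := hmain
    _ ≤ _ := pow_le_pow_left₀ (Finset.sum_nonneg fun i _ =>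
        mul_nonneg (hw i) (mul_nonneg hC0 (hper0 i))) hR 4


/-! ### Ingredients of the assembly: thin spheres, quartic growth, partial sums -/

/-- If `x ∈ 𝓑_m` has a horizontal neighbour `x·σ` outside `𝓑_m`, then `x ∉ 𝓑_{m-1}` (`x` lies on
the sphere). [cite: NaorYoung2018, §1.3] -/
theorem not_mem_wordBall_pred_of_gen {m : ℕ} (hm : 1 ≤ m) {x σ : ℤ × ℤ × ℤ}
    (hσ : σ ∈ ({(1, 0, 0), (-1, 0, 0), (0, 1, 0), (0, -1, 0)} : Finset (ℤ × ℤ × ℤ)))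
    (hout : heisMul x σ ∉ wordBall m) : x ∉ wordBall (m - 1) := by
  intro hx
  apply hout
  rw [mem_wordBall_iff_dist_le] at hx ⊢
  have h1 : cayleyGraph.dist x (heisMul x σ) ≤ 1 := dist_heisMul_gen_le_one x σ hσ
  have h2 : cayleyGraph.dist (0, 0, 0) (heisMul x σ) ≤
      cayleyGraph.dist (0, 0, 0) x + cayleyGraph.dist x (heisMul x σ) :=
    cayleyGraph_connected.dist_triangle
  omega

/-- **A thin sphere by pigeonhole**: for `M ≥ 1` some `m ∈ (M, 2M]` has
`|𝓑_m ∖ 𝓑_{m-1}| ≤ |𝓑_{2M}|/M` (the sphere sizes over `(M, 2M]` add up to at most `|𝓑_{2M}|`).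
[folklore] -/
theorem exists_thin_sphere {M : ℕ} (hM : 1 ≤ M) : ∃ m : ℕ, M < m ∧ m ≤ 2 * M ∧
    ((((wordBall_finite m).toFinset \ (wordBall_finite (m - 1)).toFinset).card : ℝ)) ≤
      ((wordBall_finite (2 * M)).toFinset.card : ℝ) / M := by
  set f : ℕ → ℝ := fun k => ((wordBall_finite k).toFinset.card : ℝ) with hf
  have hf0 : ∀ k, 0 ≤ f k := fun k => by positivity
  have htel : ∑ i ∈ Finset.range M, (f (M + (i + 1)) - f (M + i)) = f (2 * M) - f M := by
    have h := Finset.sum_range_sub (fun i => f (M + i)) M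
    simp only [add_zero] at h
    rw [show M + M = 2 * M by ring] at h
    rw [← h]
  have hle : ∑ i ∈ Finset.range M, (f (M + (i + 1)) - f (M + i)) ≤
      ∑ _i ∈ Finset.range M, f (2 * M) / M := by
    rw [htel, Finset.sum_const, Finset.card_range, nsmul_eq_mul]
    have hM0 : (M : ℝ) ≠ 0 := by exact_mod_cast (by omega : M ≠ 0)
    have h1 : (M : ℝ) * (f (2 * M) / M) = f (2 * M) := by field_simp
    rw [h1]
    linarith [hf0 M]
  obtain ⟨i, hi, hfi⟩ := Finset.exists_le_of_sum_le (Finset.nonempty_range_iff.mpr (by omega)) hle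
  rw [Finset.mem_range] at hi
  refine ⟨M + (i + 1), by omega, by omega, ?_⟩
  have hsub : (wordBall_finite (M + (i + 1) - 1)).toFinset ⊆ (wordBall_finite (M + (i + 1))).toFinset :=
    wordBall_toFinset_mono (by omega)
  rw [Finset.card_sdiff_of_subset hsub, Nat.cast_sub (Finset.card_le_card hsub)]
  rw [show M + (i + 1) - 1 = M + i by omega]
  exact hfi

/-- **Quartic growth, ratio form**: `|𝓑_{18n}| ≤ 6·10⁹ · |𝓑_n|` for `n ≥ 20` (from
`|𝓑_r| ≤ (2r+1)²(2r²+1)` and `(2k+1)²(2k²+1) ≤ |𝓑_{10k}|`, `k = ⌊n/10⌋`).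
[cite: CheegerKleinerNaor2011, §1.1 Rem. 1.4] -/
theorem ncard_wordBall_mul_le {n : ℕ} (hn : 20 ≤ n) :
    (wordBall (18 * n)).ncard ≤ 6000000000 * (wordBall n).ncard := by
  set k := n / 10 with hk
  have hk2 : 2 ≤ k := by omega
  have hnk : n ≤ 15 * k := by omega
  have h10 : 10 * k ≤ n := by omega
  have hup : (wordBall (18 * n)).ncard ≤ (2 * (18 * n) + 1) ^ 2 * (2 * (18 * n) ^ 2 + 1) :=
    ncard_wordBall_le (18 * n)
  have hlow : (2 * k + 1) ^ 2 * (2 * k ^ 2 + 1) ≤ (wordBall n).ncard :=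
    (le_ncard_wordBall k).trans (Set.ncard_le_ncard (wordBall_mono h10) (wordBall_finite n))
  have e1 : 2 * (18 * n) + 1 ≤ 541 * k := by omega
  have e2 : 2 * (18 * n) ^ 2 + 1 ≤ 145801 * k ^ 2 := by
    have h1 : n ^ 2 ≤ (15 * k) ^ 2 := Nat.pow_le_pow_left hnk 2
    have h2 : 1 ≤ k ^ 2 := Nat.one_le_pow _ _ (by omega)
    calc 2 * (18 * n) ^ 2 + 1 = 648 * n ^ 2 + 1 := by ring
      _ ≤ 648 * (15 * k) ^ 2 + k ^ 2 := add_le_add (Nat.mul_le_mul_left _ h1) h2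
      _ = 145801 * k ^ 2 := by ring
  have e3 : (2 * (18 * n) + 1) ^ 2 * (2 * (18 * n) ^ 2 + 1) ≤ (541 * k) ^ 2 * (145801 * k ^ 2) :=
    Nat.mul_le_mul (Nat.pow_le_pow_left e1 2) e2
  have e4 : 8 * k ^ 4 ≤ (2 * k + 1) ^ 2 * (2 * k ^ 2 + 1) :=
    calc 8 * k ^ 4 ≤ 8 * k ^ 4 + (8 * k ^ 3 + 6 * k ^ 2 + 4 * k + 1) := Nat.le_add_right _ _
      _ = (2 * k + 1) ^ 2 * (2 * k ^ 2 + 1) := by ring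
  have e5 : (541 * k) ^ 2 * (145801 * k ^ 2) ≤ 6000000000 * (8 * k ^ 4) :=
    calc (541 * k) ^ 2 * (145801 * k ^ 2) = 42673182481 * k ^ 4 := by ring
      _ ≤ 48000000000 * k ^ 4 := Nat.mul_le_mul_right _ (by norm_num)
      _ = 6000000000 * (8 * k ^ 4) := by ring
  calc (wordBall (18 * n)).ncard ≤ (2 * (18 * n) + 1) ^ 2 * (2 * (18 * n) ^ 2 + 1) := hup
    _ ≤ (541 * k) ^ 2 * (145801 * k ^ 2) := e3
    _ ≤ 6000000000 * (8 * k ^ 4) := e5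
    _ ≤ 6000000000 * ((2 * k + 1) ^ 2 * (2 * k ^ 2 + 1)) := Nat.mul_le_mul_left _ e4
    _ ≤ 6000000000 * (wordBall n).ncard := Nat.mul_le_mul_left _ hlow

/-- **Un-rooted partial sums of the vertical-perimeter series.** From
`(Σ_{t≥1} |∂ᵗ_v Ω|⁴/t³)^{1/4} ≤ C |∂_h Ω|` (the series converges: `|∂ᵗ_v Ω| ≤ 2|Ω|`) one gets
`Σ_{t=1}^{T} |∂ᵗ_v Ω|⁴/t³ ≤ (C |∂_h Ω|)⁴` for every `T`. [cite: NaorYoung2018, §1 Rem. 1.4] -/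
theorem partialSum_vper_le {C : ℝ} (Ω : Finset (ℤ × ℤ × ℤ)) {H : ℝ}
    (hX : (∑' t : ℕ, (((Ω.filter fun x => (x.1, x.2.1, x.2.2 + ((t : ℤ) + 1)) ∉ Ω).card : ℝ) +
        ((Ω.filter fun x => (x.1, x.2.1, x.2.2 - ((t : ℤ) + 1)) ∉ Ω).card : ℝ)) ^ 4 /
        ((t : ℝ) + 1) ^ 3) ^ (1 / 4 : ℝ) ≤ C * H) (T : ℕ) :
    ∑ t ∈ Finset.range T, (((Ω.filter fun x => (x.1, x.2.1, x.2.2 + ((t : ℤ) + 1)) ∉ Ω).card : ℝ) +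
        ((Ω.filter fun x => (x.1, x.2.1, x.2.2 - ((t : ℤ) + 1)) ∉ Ω).card : ℝ)) ^ 4 /
        ((t : ℝ) + 1) ^ 3 ≤ (C * H) ^ 4 := by
  set a : ℕ → ℝ := fun t => (((Ω.filter fun x => (x.1, x.2.1, x.2.2 + ((t : ℤ) + 1)) ∉ Ω).card : ℝ) +
      ((Ω.filter fun x => (x.1, x.2.1, x.2.2 - ((t : ℤ) + 1)) ∉ Ω).card : ℝ)) ^ 4 /
      ((t : ℝ) + 1) ^ 3 with ha
  have ha0 : ∀ t, 0 ≤ a t := fun t => by positivity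
  -- summability: terms `≤ (2|Ω|)⁴ / (t+1)³`
  have hbd : ∀ t, a t ≤ (2 * (Ω.card : ℝ)) ^ 4 * (1 / ((t : ℝ) + 1) ^ 3) := by
    intro t
    have h1 : (((Ω.filter fun x => (x.1, x.2.1, x.2.2 + ((t : ℤ) + 1)) ∉ Ω).card : ℝ)) ≤ Ω.card := by
      exact_mod_cast card_filter_le _ _
    have h2 : (((Ω.filter fun x => (x.1, x.2.1, x.2.2 - ((t : ℤ) + 1)) ∉ Ω).card : ℝ)) ≤ Ω.card := by
      exact_mod_cast card_filter_le _ _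
    have hpos : (0 : ℝ) < ((t : ℝ) + 1) ^ 3 := by positivity
    rw [ha, mul_one_div]
    exact div_le_div_of_nonneg_right (pow_le_pow_left₀ (by positivity) (by linarith) 4) hpos.le
  have hsum : Summable a := by
    have h3 : Summable fun t : ℕ => 1 / ((t : ℝ) + 1) ^ 3 := by
      have h := (summable_nat_add_iff 1).mpr (Real.summable_one_div_nat_pow.mpr (by norm_num : 1 < 3))
      simpa using h
    exact (h3.mul_left ((2 * (Ω.card : ℝ)) ^ 4)).of_nonneg_of_le ha0 hbd
  set S : ℝ := ∑' t : ℕ, a t with hS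
  have hS0 : 0 ≤ S := tsum_nonneg ha0
  have hle : ∑ t ∈ Finset.range T, a t ≤ S := hsum.sum_le_tsum (Finset.range T) fun t _ => ha0 t
  have hS4 : S = (S ^ (1 / 4 : ℝ)) ^ 4 := by
    rw [← Real.rpow_natCast, ← Real.rpow_mul hS0]
    norm_num
  calc ∑ t ∈ Finset.range T, a t ≤ S := hle
    _ = (S ^ (1 / 4 : ℝ)) ^ 4 := hS4
    _ ≤ (C * H) ^ 4 := pow_le_pow_left₀ (Real.rpow_nonneg hS0 _) hX 4


/-- `log(T+1) ≤ Σ_{t=1}^{T} 1/t` (`log_add_one_le_harmonic`). [folklore] -/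
theorem log_succ_le_sum_range_inv (T : ℕ) :
    Real.log ((T : ℝ) + 1) ≤ ∑ t ∈ Finset.range T, 1 / ((t : ℝ) + 1) := by
  have h := log_add_one_le_harmonic T
  have hcast : ((harmonic T : ℚ) : ℝ) = ∑ t ∈ Finset.range T, 1 / ((t : ℝ) + 1) := by
    simp only [harmonic, one_div]
    push_cast
    rfl
  rw [hcast] at h
  simpa using h

/-! ### The main theorem -/

namespace CheegerKleinerNaor2011_wordBall_l1Distortion

/-- **The Cheeger–Kleiner–Naor bound from the un-rooted partial sums of the vertical-perimeter
series** (the form in which the isoperimetric inequality is consumed): if there is `C > 0` with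
`Σ_{t=1}^{T} |∂ᵗ_v Ω|⁴/t³ ≤ (C |∂_h Ω|)⁴` for all finite `Ω ⊂ ℍ_ℤ³` and all `T` (boundaries in the
counted form), then `CheegerKleinerNaor2011_wordBall_l1Distortion` holds, with `δ = 1/4`. This is
the whole argument of [NY18, §1.3 p. 8] (`local_vertical_le` for the embedding on `𝓑_m`,
`m ∈ (9n, 18n]` a thin-sphere radius, `n = ⌊r/18⌋`; `V_t ≥ |𝓑_n| d_W(1,cᵗ) ≥ |𝓑_n| √t`,
`Σ_{t≤n²} 1/t ≥ log r`, `R ≤ 12 D |𝓑_{18n}|`, quartic growth), giving `log r ≤ (12·C·Λ·D)⁴`,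
`Λ = 6·10⁹`, for `r ≥ 400`, and `D ≥ 1` below; `of_verticalVsHorizontal` feeds it the partial sums
of the convergent series. [cite: NaorYoung2018, §1 Def. 1.1, Rem. 1.4, §1.3]
[cite: NaorYoung2022, Thm. 1.1 and §1.1.1] -/
theorem of_partialSums
    (hP : ∃ C : ℝ, 0 < C ∧ ∀ (Ω : Finset (ℤ × ℤ × ℤ)) (T : ℕ),
      ∑ t ∈ Finset.range T,
        (((Ω.filter fun x => (x.1, x.2.1, x.2.2 + ((t : ℤ) + 1)) ∉ Ω).card : ℝ) +
          ((Ω.filter fun x => (x.1, x.2.1, x.2.2 - ((t : ℤ) + 1)) ∉ Ω).card : ℝ)) ^ 4 /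
          ((t : ℝ) + 1) ^ 3 ≤
      (C * ((Ω ×ˢ ({(1, 0, 0), (-1, 0, 0), (0, 1, 0), (0, -1, 0)} : Finset (ℤ × ℤ × ℤ))).filter
          fun p => heisMul p.1 p.2 ∉ Ω).card) ^ 4) :
    CheegerKleinerNaor2011_wordBall_l1Distortion := by
  classical
  obtain ⟨C, hC, hCps⟩ := hP
  -- constants
  set Λ : ℝ := 6000000000 with hΛ
  have hΛ0 : 0 < Λ := by norm_num
  have hL400 : 0 < Real.log 400 := Real.log_pos (by norm_num)
  have hκ1 : 0 < (Real.log 400 ^ (1 / 4 : ℝ))⁻¹ := by positivity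
  have hκ2 : 0 < 1 / (12 * C * Λ) := by positivity
  refine ⟨1 / 4, by norm_num, min ((Real.log 400 ^ (1 / 4 : ℝ))⁻¹) (1 / (12 * C * Λ)),
    lt_min hκ1 hκ2, ?_⟩
  intro r hr N f D hf
  have hlog0 : 0 ≤ Real.log r := Real.log_nonneg (by exact_mod_cast (by omega : 1 ≤ r))
  -- `D ≥ 1` from the pair `1`, `a` at word distance `1`
  have hD1 : 1 ≤ D := by
    obtain ⟨h1, h2⟩ := hf (0, 0, 0) (1, 0, 0) (zero_mem_wordBall r) (genA_mem_wordBall (by omega))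
    rw [dist_zero_genA] at h1 h2
    simp only [Nat.cast_one, mul_one] at h1 h2
    linarith
  have hD0 : 0 ≤ D := zero_le_one.trans hD1
  by_cases h400 : r < 400
  · -- small radii: `κ (log r)^{1/4} ≤ (log 400)^{-1/4} (log 400)^{1/4} = 1 ≤ D`
    have h1 : Real.log r ^ (1 / 4 : ℝ) ≤ Real.log 400 ^ (1 / 4 : ℝ) :=
      Real.rpow_le_rpow hlog0 (Real.log_le_log (by positivity) (by exact_mod_cast h400.le))
        (by norm_num)
    calc min ((Real.log 400 ^ (1 / 4 : ℝ))⁻¹) (1 / (12 * C * Λ)) * Real.log r ^ (1 / 4 : ℝ)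
        ≤ (Real.log 400 ^ (1 / 4 : ℝ))⁻¹ * Real.log 400 ^ (1 / 4 : ℝ) :=
          mul_le_mul (min_le_left _ _) h1 (Real.rpow_nonneg hlog0 _) hκ1.le
      _ = 1 := inv_mul_cancel₀ (by positivity)
      _ ≤ D := hD1
  -- large radii
  rw [not_lt] at h400
  set n := r / 18 with hn
  have hn20 : 20 ≤ n := by omega
  have hn1 : 1 ≤ n := by omega
  have h18 : 18 * n ≤ r := by omega
  have hsq : r ≤ n * n := by
    have : 20 * n ≤ n * n := Nat.mul_le_mul_right n hn20
    omega
  -- a thin sphere radius `m ∈ (9n, 18n]`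
  obtain ⟨m, hm1, hm2, hthin⟩ := exists_thin_sphere (M := 9 * n) (by omega)
  have hmr : m ≤ r := by omega
  have h9 : 9 * n ≤ m := by omega
  have hm0 : 1 ≤ m := by omega
  set Bn := (wordBall_finite n).toFinset with hBn
  set Bm := (wordBall_finite m).toFinset with hBm
  set B18 := (wordBall_finite (2 * (9 * n))).toFinset with hB18
  set gens : Finset (ℤ × ℤ × ℤ) := {(1, 0, 0), (-1, 0, 0), (0, 1, 0), (0, -1, 0)} with hgens
  have hgens4 : (gens.card : ℝ) ≤ 4 := by
    have h : gens.card ≤ 4 := by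
      rw [hgens]
      refine (card_insert_le _ _).trans ?_
      refine Nat.succ_le_succ ((card_insert_le _ _).trans ?_)
      refine Nat.succ_le_succ ((card_insert_le _ _).trans ?_)
      simp
    exact_mod_cast h
  have hBm_r : ∀ x ∈ Bm, x ∈ wordBall r := fun x hx =>
    wordBall_mono hmr ((wordBall_toFinset_mem).mp hx)
  have hBn_r : ∀ x ∈ Bn, x ∈ wordBall r := fun x hx =>
    wordBall_mono (by omega) ((wordBall_toFinset_mem).mp hx)
  have he_r : ((0 : ℤ), (0 : ℤ), (0 : ℤ)) ∈ wordBall r := zero_mem_wordBall r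
  -- the local inequality for `f` on `𝓑_m`
  have hloc := local_vertical_le hC.le hCps f hn1 h9
  -- (i) the right-hand side: `R ≤ 12 D |𝓑_{18n}|`
  set B' := (wordBall_finite (m - 1)).toFinset with hB'
  have hterm : ∀ x ∈ Bm, ∀ σ ∈ gens,
      (if heisMul x σ ∈ Bm then ∑ k, |f x k - f (heisMul x σ) k|
        else ∑ k, |f x k - f (0, 0, 0) k|) ≤ D + (if x ∈ B' then 0 else D * m) := by
    intro x hx σ hσ
    by_cases hB : heisMul x σ ∈ Bm
    · -- `x σ ∈ 𝓑_m`: `‖f x − f(xσ)‖ ≤ D d(x, xσ) ≤ D`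
      rw [if_pos hB]
      have h := (hf x (heisMul x σ) (hBm_r x hx) (hBm_r _ hB)).2
      have hd : (cayleyGraph.dist x (heisMul x σ) : ℝ) ≤ 1 := by
        exact_mod_cast dist_heisMul_gen_le_one x σ hσ
      have hite0 : 0 ≤ (if x ∈ B' then 0 else D * m) := by split_ifs <;> positivity
      nlinarith
    · -- `x σ ∉ 𝓑_m`, so `x` lies on the sphere: `‖f x − f 1‖ ≤ D d(x, 1) ≤ D m`
      rw [if_neg hB]
      have hxB' : x ∉ B' := fun hxB' =>
        not_mem_wordBall_pred_of_gen hm0 hσ (fun h => hB ((wordBall_toFinset_mem).mpr h))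
          ((wordBall_toFinset_mem).mp hxB')
      rw [if_neg hxB']
      have h := (hf x (0, 0, 0) (hBm_r x hx) he_r).2
      have hd : (cayleyGraph.dist x (0, 0, 0) : ℝ) ≤ m := by
        have h1 : cayleyGraph.dist (0, 0, 0) x ≤ m :=
          (mem_wordBall_iff_dist_le).mp ((wordBall_toFinset_mem).mp hx)
        rw [SimpleGraph.dist_comm] at h1
        exact_mod_cast h1
      nlinarith
  have hR : ∑ x ∈ Bm, ∑ σ ∈ gens,
      (if heisMul x σ ∈ Bm then ∑ k, |f x k - f (heisMul x σ) k|
        else ∑ k, |f x k - f (0, 0, 0) k|) ≤ 12 * D * B18.card := by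
    have hcardBm : (Bm.card : ℝ) ≤ B18.card := by
      exact_mod_cast card_le_card (wordBall_toFinset_mono hm2)
    have hsphere : ((Bm.filter fun x => x ∉ B').card : ℝ) ≤ B18.card / (9 * n : ℕ) := by
      rw [← Finset.sdiff_eq_filter]
      exact hthin
    have hn9 : (0 : ℝ) < (9 * n : ℕ) := by exact_mod_cast (by omega : 0 < 9 * n)
    have hm18 : (m : ℝ) ≤ 2 * (9 * n : ℕ) := by exact_mod_cast hm2
    calc ∑ x ∈ Bm, ∑ σ ∈ gens,
          (if heisMul x σ ∈ Bm then ∑ k, |f x k - f (heisMul x σ) k|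
            else ∑ k, |f x k - f (0, 0, 0) k|)
        ≤ ∑ x ∈ Bm, ∑ _σ ∈ gens, (D + (if x ∈ B' then 0 else D * m)) :=
          Finset.sum_le_sum fun x hx => Finset.sum_le_sum fun σ hσ => hterm x hx σ hσ
      _ ≤ ∑ x ∈ Bm, 4 * (D + (if x ∈ B' then 0 else D * m)) := by
          refine Finset.sum_le_sum fun x _ => ?_
          rw [Finset.sum_const, nsmul_eq_mul]
          have hite0 : 0 ≤ D + (if x ∈ B' then 0 else D * m) := by split_ifs <;> positivity
          exact mul_le_mul_of_nonneg_right hgens4 hite0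
      _ = 4 * D * Bm.card + 4 * (D * m) * ((Bm.filter fun x => x ∉ B').card : ℝ) := by
          rw [natCast_card_filter, Finset.mul_sum]
          have h1 : (4 * D * (Bm.card : ℝ)) = ∑ _x ∈ Bm, 4 * D := by
            rw [Finset.sum_const, nsmul_eq_mul]
            ring
          rw [h1, ← Finset.sum_add_distrib]
          refine Finset.sum_congr rfl fun x _ => ?_
          by_cases hx : x ∈ B'
          · rw [if_pos hx, if_neg (not_not_intro hx)]
            ring
          · rw [if_neg hx, if_pos hx]
            ring
      _ ≤ 4 * D * B18.card + 4 * (D * m) * (B18.card / (9 * n : ℕ)) := by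
          gcongr
      _ ≤ 4 * D * B18.card + 4 * (D * (2 * (9 * n : ℕ))) * (B18.card / (9 * n : ℕ)) := by
          gcongr
      _ = 12 * D * B18.card := by
          field_simp
          ring
  -- (ii) the left-hand side: `Σ_{t<n²} V_t⁴/(t+1)³ ≥ |𝓑_n|⁴ log r`
  have hV : ∀ t ∈ Finset.range (n ^ 2),
      (Bn.card : ℝ) ^ 4 * (1 / ((t : ℝ) + 1)) ≤
        (∑ h ∈ Bn, ∑ k, |f (h.1, h.2.1, h.2.2 + ((t : ℤ) + 1)) k - f h k|) ^ 4 /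
          ((t : ℝ) + 1) ^ 3 := by
    intro t ht
    rw [Finset.mem_range] at ht
    set d0 : ℕ := cayleyGraph.dist ((0 : ℤ), (0 : ℤ), (0 : ℤ)) (0, 0, (t : ℤ) + 1) with hd0
    -- each term is at least `d0`, and `d0² ≥ t + 1`
    have hd0sq : ((t : ℝ) + 1) ≤ (d0 : ℝ) ^ 2 := by
      have h := le_dist_center_sq ((t : ℤ) + 1)
      rw [abs_of_nonneg (by positivity)] at h
      rw [hd0]
      exact_mod_cast h
    have hVt : (Bn.card : ℝ) * d0 ≤
        ∑ h ∈ Bn, ∑ k, |f (h.1, h.2.1, h.2.2 + ((t : ℤ) + 1)) k - f h k| := by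
      have h1 : ∀ h ∈ Bn, (d0 : ℝ) ≤ ∑ k, |f (h.1, h.2.1, h.2.2 + ((t : ℤ) + 1)) k - f h k| := by
        intro h hh
        have hup : (h.1, h.2.1, h.2.2 + ((t : ℤ) + 1)) ∈ wordBall r := by
          have habs : |(t : ℤ) + 1| ≤ 2 * (n : ℤ) ^ 2 := by
            rw [abs_of_nonneg (by positivity)]
            have h1 : t + 1 ≤ n ^ 2 := ht
            have h2 : ((t : ℤ) + 1) ≤ (n : ℤ) ^ 2 := by exact_mod_cast h1
            nlinarith
          exact wordBall_mono (by omega)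
            (vshift_mem_wordBall (m := n) hn1 habs ((wordBall_toFinset_mem).mp hh))
        have h2 := (hf (h.1, h.2.1, h.2.2 + ((t : ℤ) + 1)) h hup (hBn_r h hh)).1
        rw [SimpleGraph.dist_comm, dist_vshift] at h2
        exact h2
      calc (Bn.card : ℝ) * d0 = ∑ _h ∈ Bn, (d0 : ℝ) := by rw [Finset.sum_const, nsmul_eq_mul]
        _ ≤ _ := Finset.sum_le_sum h1
    have hL0 : 0 ≤ (Bn.card : ℝ) * d0 := by positivity
    have hpos : (0 : ℝ) < (t : ℝ) + 1 := by positivity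
    calc (Bn.card : ℝ) ^ 4 * (1 / ((t : ℝ) + 1))
        = (Bn.card : ℝ) ^ 4 * ((t : ℝ) + 1) ^ 2 / ((t : ℝ) + 1) ^ 3 := by
          field_simp
      _ ≤ ((Bn.card : ℝ) * d0) ^ 4 / ((t : ℝ) + 1) ^ 3 := by
          apply div_le_div_of_nonneg_right _ (by positivity)
          calc (Bn.card : ℝ) ^ 4 * ((t : ℝ) + 1) ^ 2 ≤ (Bn.card : ℝ) ^ 4 * ((d0 : ℝ) ^ 2) ^ 2 := by
                gcongr
            _ = ((Bn.card : ℝ) * d0) ^ 4 := by ring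
      _ ≤ _ := by
          apply div_le_div_of_nonneg_right _ (by positivity)
          exact pow_le_pow_left₀ hL0 hVt 4
  have hlow : (Bn.card : ℝ) ^ 4 * Real.log r ≤
      ∑ t ∈ Finset.range (n ^ 2),
        (∑ h ∈ Bn, ∑ k, |f (h.1, h.2.1, h.2.2 + ((t : ℤ) + 1)) k - f h k|) ^ 4 /
          ((t : ℝ) + 1) ^ 3 := by
    have hlogr : Real.log r ≤ ∑ t ∈ Finset.range (n ^ 2), 1 / ((t : ℝ) + 1) := by
      refine le_trans ?_ (log_succ_le_sum_range_inv (n ^ 2))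
      refine Real.log_le_log (by exact_mod_cast (by omega : 0 < r)) ?_
      have h1 : (r : ℝ) ≤ (n : ℝ) * n := by exact_mod_cast hsq
      push_cast
      nlinarith
    calc (Bn.card : ℝ) ^ 4 * Real.log r
        ≤ (Bn.card : ℝ) ^ 4 * ∑ t ∈ Finset.range (n ^ 2), 1 / ((t : ℝ) + 1) :=
          mul_le_mul_of_nonneg_left hlogr (by positivity)
      _ = ∑ t ∈ Finset.range (n ^ 2), (Bn.card : ℝ) ^ 4 * (1 / ((t : ℝ) + 1)) := by
          rw [Finset.mul_sum]
      _ ≤ _ := Finset.sum_le_sum hV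
  -- (iii) combine: `|𝓑_n|⁴ log r ≤ (C R)⁴ ≤ (12 C D |𝓑_{18n}|)⁴ ≤ (12 C Λ D)⁴ |𝓑_n|⁴`
  have hgrowth : (B18.card : ℝ) ≤ Λ * Bn.card := by
    have h := ncard_wordBall_mul_le hn20
    rw [hB18, hBn, card_wordBall_toFinset, card_wordBall_toFinset,
      show 2 * (9 * n) = 18 * n by ring, hΛ]
    exact_mod_cast h
  have hBn0 : (0 : ℝ) < Bn.card := by
    have h : ((0 : ℤ), (0 : ℤ), (0 : ℤ)) ∈ Bn := (wordBall_toFinset_mem).mpr (zero_mem_wordBall n)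
    exact_mod_cast Finset.card_pos.mpr ⟨_, h⟩
  have hR0 : 0 ≤ ∑ x ∈ Bm, ∑ σ ∈ gens,
      (if heisMul x σ ∈ Bm then ∑ k, |f x k - f (heisMul x σ) k|
        else ∑ k, |f x k - f (0, 0, 0) k|) :=
    Finset.sum_nonneg fun x _ => Finset.sum_nonneg fun σ _ => by split_ifs <;> positivity
  have hkey : (Bn.card : ℝ) ^ 4 * Real.log r ≤ (12 * C * Λ * D) ^ 4 * (Bn.card : ℝ) ^ 4 :=
    calc (Bn.card : ℝ) ^ 4 * Real.log r
        ≤ (C * ∑ x ∈ Bm, ∑ σ ∈ gens,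
            (if heisMul x σ ∈ Bm then ∑ k, |f x k - f (heisMul x σ) k|
              else ∑ k, |f x k - f (0, 0, 0) k|)) ^ 4 := hlow.trans hloc
      _ ≤ (C * (12 * D * B18.card)) ^ 4 :=
          pow_le_pow_left₀ (mul_nonneg hC.le hR0) (mul_le_mul_of_nonneg_left hR hC.le) 4
      _ ≤ (C * (12 * D * (Λ * Bn.card))) ^ 4 := by gcongr
      _ = (12 * C * Λ * D) ^ 4 * (Bn.card : ℝ) ^ 4 := by ring
  have hlogle : Real.log r ≤ (12 * C * Λ * D) ^ 4 :=
    le_of_mul_le_mul_left (by linarith [hkey]) (pow_pos hBn0 4)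
  -- `(log r)^{1/4} ≤ 12 C Λ D`
  have hK0 : 0 ≤ 12 * C * Λ * D := by positivity
  have hroot : Real.log r ^ (1 / 4 : ℝ) ≤ 12 * C * Λ * D := by
    calc Real.log r ^ (1 / 4 : ℝ) ≤ ((12 * C * Λ * D) ^ 4) ^ (1 / 4 : ℝ) :=
          Real.rpow_le_rpow hlog0 hlogle (by norm_num)
      _ = 12 * C * Λ * D := by
          rw [← Real.rpow_natCast, ← Real.rpow_mul hK0]
          norm_num
  calc min ((Real.log 400 ^ (1 / 4 : ℝ))⁻¹) (1 / (12 * C * Λ)) * Real.log r ^ (1 / 4 : ℝ)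
      ≤ (1 / (12 * C * Λ)) * (12 * C * Λ * D) :=
        mul_le_mul (min_le_right _ _) hroot (Real.rpow_nonneg hlog0 _) hκ2.le
    _ = D := by
        field_simp


/-- **The Cheeger–Kleiner–Naor bound from the Naor–Young isoperimetric inequality.** Assume the
endpoint (`q = 4`) discrete vertical-versus-horizontal isoperimetric inequality on `ℍ_ℤ³` — the
display of [NY18, Rem. 1.4] with `q = 4`, established in [NY22, Thm. 1.1 with §1.1.1]: there is a
constant `C` such that for every finite `Ω ⊂ ℍ_ℤ³ = ⟨a, b⟩`,
`(Σ_{t=1}^∞ |∂ᵗ_v Ω|⁴ / t³)^{1/4} ≤ C |∂_h Ω|`,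
`∂ᵗ_v Ω = {(x,y) ∈ Ω × Ωᶜ : x⁻¹y ∈ {cᵗ, c⁻ᵗ}}`, `∂_h Ω = {(x,y) ∈ Ω × Ωᶜ : x⁻¹y ∈ {a^{±1}, b^{±1}}}`
[NY18, Def. 1.1], transcribed on the carrier `ℤ × ℤ × ℤ` (`heisMul`, `c = [a,b] = (0,0,1)`) with
the two cardinalities counted as `#{x ∈ Ω : x·cᵗ ∉ Ω} + #{x ∈ Ω : x·c⁻ᵗ ∉ Ω}` and
`#{(x,σ) ∈ Ω × 𝔖₁ : x·σ ∉ Ω}`. THEN the vendored [CKN, Cor. 1.2] holds, with `δ = 1/4`: every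
`D`-embedding of the word ball `𝔅_r` into `ℓ₁^N` has `D ≥ κ (log r)^{1/4}` — the lower half of
`c_{ℓ₁}(𝓑_n) ≍ ⁴√(log n)` [NY22, Thm. 1.6]. The argument is that of [NY18, §1.3 p. 8]
(`local_vertical_le` for the embedding on `𝓑_m`, `m ∈ (9n, 18n]` a thin-sphere radius,
`n = ⌊r/18⌋`; `V_t ≥ |𝓑_n| d_W(1,cᵗ) ≥ |𝓑_n| √t`, `Σ_{t≤n²} 1/t ≥ log r`, `R ≤ 12 D |𝓑_{18n}|`,
quartic growth), giving `log r ≤ (12·C·Λ·D)⁴`, `Λ = 6·10⁹`, for `r ≥ 400`, and `D ≥ 1` below.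
[cite: NaorYoung2022, Thm. 1.1, §1.1.1 and Thm. 1.6] [cite: NaorYoung2018, §1 Def. 1.1, Rem. 1.4, §1.3]
[cite: CheegerKleinerNaor2011, §1.1 Cor. 1.2] -/
theorem of_verticalVsHorizontal
    (hX : ∃ C : ℝ, 0 < C ∧ ∀ Ω : Finset (ℤ × ℤ × ℤ),
      (∑' t : ℕ, (((Ω.filter fun x => (x.1, x.2.1, x.2.2 + ((t : ℤ) + 1)) ∉ Ω).card : ℝ) +
          ((Ω.filter fun x => (x.1, x.2.1, x.2.2 - ((t : ℤ) + 1)) ∉ Ω).card : ℝ)) ^ 4 /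
          ((t : ℝ) + 1) ^ 3) ^ (1 / 4 : ℝ) ≤
        C * ((Ω ×ˢ ({(1, 0, 0), (-1, 0, 0), (0, 1, 0), (0, -1, 0)} : Finset (ℤ × ℤ × ℤ))).filter
          fun p => heisMul p.1 p.2 ∉ Ω).card) :
    CheegerKleinerNaor2011_wordBall_l1Distortion := by
  obtain ⟨C, hC, hXC⟩ := hX
  exact of_partialSums ⟨C, hC, fun Ω T => partialSum_vper_le Ω (hXC Ω) T⟩

/-! ### The hypothesis with the boundaries as the printed sets of ordered pairs -/

/-- `|∂_h Ω|` as printed — the set of ordered pairs `(x, y)` with `x ∈ Ω`, `y ∉ Ω`, `y = x·σ`,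
`σ ∈ 𝔖₁` — has cardinality `#{(x,σ) ∈ Ω × 𝔖₁ : x·σ ∉ Ω}` (`σ ↦ x·σ` is injective).
[cite: NaorYoung2018, §1 Def. 1.1] -/
theorem card_hBoundaryPairs (Ω : Finset (ℤ × ℤ × ℤ)) :
    ((((Ω ×ˢ ({(1, 0, 0), (-1, 0, 0), (0, 1, 0), (0, -1, 0)} : Finset (ℤ × ℤ × ℤ))).image
        fun p => (p.1, heisMul p.1 p.2)).filter fun q => q.2 ∉ Ω).card) =
      ((Ω ×ˢ ({(1, 0, 0), (-1, 0, 0), (0, 1, 0), (0, -1, 0)} : Finset (ℤ × ℤ × ℤ))).filter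
        fun p => heisMul p.1 p.2 ∉ Ω).card := by
  classical
  rw [Finset.filter_image]
  refine Finset.card_image_of_injOn ?_
  rintro ⟨x, σ⟩ _ ⟨x', σ'⟩ _ hpp
  simp only [Prod.mk.injEq] at hpp
  obtain ⟨rfl, h2⟩ := hpp
  obtain ⟨x1, x2, x3⟩ := x
  obtain ⟨s1, s2, s3⟩ := σ
  obtain ⟨s1', s2', s3'⟩ := σ'
  simp only [heisMul, Prod.mk.injEq] at h2
  obtain ⟨e1, e2, e3⟩ := h2
  have f1 : s1 = s1' := by linarith
  have f2 : s2 = s2' := by linarith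
  have f3 : s3 = s3' := by rw [f2] at e3; linarith
  rw [f1, f2, f3]

/-- `|∂ᵗ_v Ω|` as printed — the set of ordered pairs `(x, y)` with `x ∈ Ω`, `y ∉ Ω`,
`y = x·c^{±t}` — has cardinality `#{x ∈ Ω : x·cᵗ ∉ Ω} + #{x ∈ Ω : x·c⁻ᵗ ∉ Ω}` for `t ≠ 0`.
[cite: NaorYoung2018, §1 Def. 1.1] -/
theorem card_vBoundaryPairs {t : ℤ} (ht : t ≠ 0) (Ω : Finset (ℤ × ℤ × ℤ)) :
    ((((Ω ×ˢ ({t, -t} : Finset ℤ)).image fun p => (p.1, heisMul p.1 (0, 0, p.2))).filter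
        fun q => q.2 ∉ Ω).card) =
      (Ω.filter fun x => (x.1, x.2.1, x.2.2 + t) ∉ Ω).card +
        (Ω.filter fun x => (x.1, x.2.1, x.2.2 - t) ∉ Ω).card := by
  classical
  rw [Finset.filter_image, Finset.card_image_of_injOn]
  · rw [Finset.card_filter, Finset.sum_product_right, Finset.sum_pair (by omega : t ≠ -t),
      Finset.card_filter, Finset.card_filter]
    congr 1
    · exact Finset.sum_congr rfl fun x _ => by rw [heisMul_center]
    · exact Finset.sum_congr rfl fun x _ => by rw [heisMul_center, ← sub_eq_add_neg]
  · rintro ⟨x, s⟩ _ ⟨x', s'⟩ _ hpp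
    simp only [Prod.mk.injEq, heisMul_center] at hpp
    obtain ⟨rfl, -, -, h3⟩ := hpp
    have : s = s' := by linarith
    rw [this]

/-- **The main theorem with `∂_h Ω`, `∂ᵗ_v Ω` as the printed sets of ordered pairs**
`{(x, y) ∈ Ω × Ωᶜ : x⁻¹y ∈ 𝔖₁}` and `{(x, y) ∈ Ω × Ωᶜ : x⁻¹y ∈ {cᵗ, c⁻ᵗ}}` [NY18, Def. 1.1]
(`x⁻¹y = g ⟺ y = x·g`; realized as the images of `(x, σ) ↦ (x, x·σ)` and
`(x, ±t) ↦ (x, x·c^{±t})` filtered by `y ∉ Ω`): if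
`(Σ_{t=1}^∞ |∂ᵗ_v Ω|⁴/t³)^{1/4} ≤ C |∂_h Ω|` for all finite `Ω ⊂ ℍ_ℤ³` — the display of
[NY18, Rem. 1.4] with `q = 4`, established in [NY22, Thm. 1.1, §1.1.1] — then
`CheegerKleinerNaor2011_wordBall_l1Distortion` holds (`card_hBoundaryPairs`, `card_vBoundaryPairs`
and `of_verticalVsHorizontal`).
[cite: NaorYoung2022, Thm. 1.1 and §1.1.1] [cite: NaorYoung2018, §1 Def. 1.1, Rem. 1.4] -/
theorem of_verticalVsHorizontal_pairs
    (hX : ∃ C : ℝ, 0 < C ∧ ∀ Ω : Finset (ℤ × ℤ × ℤ),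
      (∑' t : ℕ, (((((Ω ×ˢ ({((t : ℤ) + 1), -((t : ℤ) + 1)} : Finset ℤ)).image
          fun p => (p.1, heisMul p.1 (0, 0, p.2))).filter fun q => q.2 ∉ Ω).card) : ℝ) ^ 4 /
          ((t : ℝ) + 1) ^ 3) ^ (1 / 4 : ℝ) ≤
        C * ((((Ω ×ˢ ({(1, 0, 0), (-1, 0, 0), (0, 1, 0), (0, -1, 0)} : Finset (ℤ × ℤ × ℤ))).image
          fun p => (p.1, heisMul p.1 p.2)).filter fun q => q.2 ∉ Ω).card)) :
    CheegerKleinerNaor2011_wordBall_l1Distortion := by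
  apply of_verticalVsHorizontal
  obtain ⟨C, hC, H⟩ := hX
  refine ⟨C, hC, fun Ω => ?_⟩
  have h := H Ω
  have ev : ∀ t : ℕ, (((((Ω ×ˢ ({((t : ℤ) + 1), -((t : ℤ) + 1)} : Finset ℤ)).image
      fun p => (p.1, heisMul p.1 (0, 0, p.2))).filter fun q => q.2 ∉ Ω).card) : ℝ) =
      ((Ω.filter fun x => (x.1, x.2.1, x.2.2 + ((t : ℤ) + 1)) ∉ Ω).card : ℝ) +
        ((Ω.filter fun x => (x.1, x.2.1, x.2.2 - ((t : ℤ) + 1)) ∉ Ω).card : ℝ) := by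
    intro t
    rw [card_vBoundaryPairs (by omega) Ω]
    push_cast
    rfl
  simp_rw [ev] at h
  rw [card_hBoundaryPairs] at h
  exact h

end CheegerKleinerNaor2011_wordBall_l1Distortion

end Literature.Geometry.MetricEmbeddings

end
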